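import Literature.Geometry.Lorentzian.CauchyDevelopmentOneJet
import Literature.Geometry.Lorentzian.HypersurfaceConstraints
import Literature.Geometry.Lorentzian.HypersurfaceMomentumConstraint
import Literature.Geometry.Lorentzian.HypersurfaceNaturality
import Literature.Geometry.Lorentzian.EventHorizonAreaLaw
import Literature.Geometry.Lorentzian.DataEmbeddingNormalSmooth
import HarnessLib

/-!
# Data admitting a vacuum data embedding satisfy the vacuum constraint equations

If the initial data set `D = (h, k)` on `X` is induced on a spacelike hypersurface of a vacuum
spacetime — i.e. `D` admits a data embedding `𝒮 = (M, g, τ, ι, ν)` (`DataEmbedding`) with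
`Ric(g) = 0` — then `D` satisfies the vacuum constraint equations
(`InitialDataSet.IsVacuumConstraintSolution`): the Hamiltonian constraint is the twice-traced Gauss
equation (`PseudoRiemannianMetric.scalarCurvature_inducedMetric_sub_normSq_add_sq_eq_zero`,
`HypersurfaceConstraints.lean`) and the momentum constraint the traced Codazzi equation
(`PseudoRiemannianMetric.divergence_sub_mvfderiv_meanCurvature_eq_zero`,
`HypersurfaceMomentumConstraint.lean`), both read through the identifications `ι^* g = h`,
`K_ν = k` of the data embedding. Choquet-Bruhat 2009, Ch. VI, Thm. 3.3 ("necessary conditions");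
Wald 1984, (10.2.28)–(10.2.30); Bartnik–Isenberg 2004, §2. In particular the data of any (vacuum)
Cauchy development are constraint-satisfying, so that statements about developable data may invoke
the existence theorems stated for solutions of the constraints.

* `PseudoRiemannianMetric.scalarCurvature_eq_of_metric_eq`, `normSq_eq_of_metric_eq`,
  `divergence_eq_of_metric_eq` — equal metrics have equal derived objects (whatever the proofs of
  the Levi-Civita hypothesis; the tree's `scalarCurvature_congr_metric` is the case of dimension 3);
* `DataEmbedding.inducedMetric_eq_metric` — `ι^* g = h` as an equality of metrics (from
  `DataEmbedding.isSpacelikeImmersion_embed` of `EventHorizonAreaLaw.lean`);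
* `InitialDataSet.isVacuumConstraintSolution_of_dataEmbedding` — the statement, under the
  hypothesis that the normal `ν` is smooth along `ι` (displayed; automatic for genuine developments).

Everything is proved; no definitions, no named facts.
-/

noncomputable section

open Bundle Set Function Module
open scoped Manifold ContDiff Topology

namespace Literature.Geometry.Lorentzian

/-! ### Equal metrics have equal derived objects -/

namespace PseudoRiemannianMetric

section Congr

variable {E : Type*} [NormedAddCommGroup E] [NormedSpace ℝ E] {H : Type*} [TopologicalSpace H]
  {I : ModelWithCorners ℝ E H} {M : Type*} [TopologicalSpace M] [ChartedSpace H M]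
  [IsManifold I ∞ M] [FiniteDimensional ℝ E] {n : ℕ∞ω}

/-- Equal metrics have equal scalar curvature (whatever the proofs of the standing Levi-Civita
hypothesis). [folklore] -/
theorem scalarCurvature_eq_of_metric_eq [CompleteSpace E]
    {g₁ g₂ : PseudoRiemannianMetric I n E (TangentSpace I : M → Type _)} (h : g₁ = g₂)
    (i₁ : g₁.HasLeviCivita) (i₂ : g₂.HasLeviCivita) (x : M) :
    g₁.scalarCurvature x = g₂.scalarCurvature x := by
  subst h; rfl

/-- Equal metrics have equal metric square norms. [folklore] -/
theorem normSq_eq_of_metric_eq {g₁ g₂ : PseudoRiemannianMetric I n E (TangentSpace I : M → Type _)}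
    (h : g₁ = g₂) (x : M) (T : LinearMap.BilinForm ℝ (TangentSpace I x)) :
    g₁.normSq x T = g₂.normSq x T := by
  subst h; rfl

/-- Equal metrics have equal metric divergences of fields of bilinear forms (whatever the proofs of
the standing Levi-Civita hypothesis). [folklore] -/
theorem divergence_eq_of_metric_eq [CompleteSpace E]
    {g₁ g₂ : PseudoRiemannianMetric I n E (TangentSpace I : M → Type _)} (h : g₁ = g₂)
    (i₁ : g₁.HasLeviCivita) (i₂ : g₂.HasLeviCivita)
    (k : Π x : M, TangentSpace I x →L[ℝ] TangentSpace I x →L[ℝ] ℝ) (x : M) :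
    g₁.divergence k x = g₂.divergence k x := by
  subst h; rfl

end Congr

end PseudoRiemannianMetric

/-! ### The constraints are necessary -/

section Necessary

universe u

variable {n : ℕ} {X : Type u} [TopologicalSpace X] [ChartedSpace (EuclideanSpace ℝ (Fin n)) X]
  [IsManifold (𝓡 n) ∞ X] [ConnectedSpace X] {D : InitialDataSet (𝓡 n) X}

namespace DataEmbedding

/-- **`ι^* g = h` as metrics**: the metric induced on `X` by the data embedding (`inducedMetric`
of the spacetime metric along `ι`) is the metric of the data. Ringström 2009, Def. 16.2.
[cite: Ringstrom2009, Def. 16.2] -/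
theorem inducedMetric_eq_metric (𝒮 : DataEmbedding D) :
    𝒮.metric.toPseudoRiemannianMetric.inducedMetric 𝒮.embed
      PseudoRiemannianMetric.contMDiff_pullbackBilin_holds 𝒮.isSpacelikeImmersion_embed =
      D.metric := by
  ext y v w
  rw [PseudoRiemannianMetric.inducedMetric_val, PseudoRiemannianMetric.inducedBilin_apply,
    𝒮.val_mfderiv_embed, InitialDataSet.val_metric]

end DataEmbedding

/-- **Data induced on a spacelike hypersurface of a vacuum spacetime satisfy the vacuum
constraints** (Choquet-Bruhat 2009, Ch. VI, Thm. 3.3, necessity; Wald 1984, (10.2.28)–(10.2.30);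
Bartnik–Isenberg 2004, §2): if the initial data set `D` admits a data embedding
`𝒮 = (M, g, τ, ι, ν)` with `Ric(g) = 0` whose normal is smooth along `ι` (true for every data
embedding), then `D` solves the vacuum constraint equations — the Hamiltonian constraint by the
twice-traced Gauss equation and the momentum constraint by the traced Codazzi equation, read
through `ι^* g = h` (`DataEmbedding.inducedMetric_eq_metric`) and `K_ν = k` (`induced_k`).
[cite: ChoquetBruhat2009, Ch. VI, Thm. 3.3] -/
theorem InitialDataSet.isVacuumConstraintSolution_of_dataEmbedding (𝒮 : DataEmbedding D)
    (h𝒮 : 𝒮.IsVacuum)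
    (hν : ContMDiff (𝓡 n) (𝓡 (n + 1)).tangent ∞
      (fun x ↦ (TotalSpace.mk' (EuclideanSpace ℝ (Fin (n + 1))) (𝒮.embed x) (𝒮.normal x) :
        TangentBundle (𝓡 (n + 1)) 𝒮.carrier)))
    [D.metric.HasLeviCivita] : D.IsVacuumConstraintSolution := by
  set g := 𝒮.metric.toPseudoRiemannianMetric with hg
  haveI hgLC : g.HasLeviCivita := 𝒮.metric.toPseudoRiemannianMetric.hasLeviCivita
  have hRic : g.IsRicciFlat := h𝒮
  have hfi := 𝒮.isSpacelikeImmersion_embed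
  have hmet := 𝒮.inducedMetric_eq_metric
  haveI hindLC := (g.inducedMetric 𝒮.embed PseudoRiemannianMetric.contMDiff_pullbackBilin_holds hfi).hasLeviCivita
  have hm : finrank ℝ (EuclideanSpace ℝ (Fin n)) = n := finrank_euclideanSpace_fin
  have hm1 : finrank ℝ (EuclideanSpace ℝ (Fin (n + 1))) = n + 1 := finrank_euclideanSpace_fin
  -- `K_ν = k`
  have hK : ∀ y, g.secondFundamentalForm (𝓡 n) 𝒮.embed 𝒮.normal y = D.kBilin y := fun y ↦
    𝒮.induced_k y
  have hKc : ∀ (y : X) (v w : TangentSpace (𝓡 n) y),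
      D.k y v w = g.secondFundamentalForm (𝓡 n) 𝒮.embed 𝒮.normal y v w := fun y v w ↦ by
    rw [hK, InitialDataSet.kBilin_apply]
  -- `tr K = tr_h k` as functions
  have hH : g.meanCurvature 𝒮.embed PseudoRiemannianMetric.contMDiff_pullbackBilin_holds hfi 𝒮.normal = D.traceK := by
    funext y
    rw [PseudoRiemannianMetric.meanCurvature, InitialDataSet.traceK, hK,
      PseudoRiemannianMetric.trace_congr (congrArg (fun m ↦ PseudoRiemannianMetric.val m y) hmet)]
  intro x
  constructor
  · -- Hamiltonian constraint: twice-traced Gauss equation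
    have hG := PseudoRiemannianMetric.scalarCurvature_inducedMetric_sub_normSq_add_sq_eq_zero g PseudoRiemannianMetric.contMDiff_pullbackBilin_holds
      hfi hν 𝒮.isFutureUnitNormal.1 hm hm1 x (hRic (𝒮.embed x))
    rw [InitialDataSet.hamiltonianConstraintFn, InitialDataSet.normSqK,
      ← congrFun hH x, PseudoRiemannianMetric.meanCurvature, ← hK,
      ← PseudoRiemannianMetric.scalarCurvature_eq_of_metric_eq hmet hindLC inferInstance x,
      ← PseudoRiemannianMetric.normSq_eq_of_metric_eq hmet x]
    exact hG
  · -- momentum constraint: traced Codazzi equation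
    refine LinearMap.ext fun v ↦ ?_
    have hKd : MDifferentiableAt (𝓡 n) ((𝓡 n).prod 𝓘(ℝ, EuclideanSpace ℝ (Fin n) →L[ℝ]
        EuclideanSpace ℝ (Fin n) →L[ℝ] ℝ))
        (fun y ↦ TotalSpace.mk' (EuclideanSpace ℝ (Fin n) →L[ℝ] EuclideanSpace ℝ (Fin n) →L[ℝ] ℝ)
          (E := fun y : X ↦ TangentSpace (𝓡 n) y →L[ℝ] TangentSpace (𝓡 n) y →L[ℝ] ℝ)
          y (D.k y)) x :=
      (D.contMDiff_k x).mdifferentiableAt (by simp)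
    have hM := PseudoRiemannianMetric.divergence_sub_mvfderiv_meanCurvature_eq_zero g PseudoRiemannianMetric.contMDiff_pullbackBilin_holds hfi hν
      𝒮.isFutureUnitNormal.1 (by norm_num) hm hm1 D.k hKc x hKd (hRic (𝒮.embed x)) v
    rw [InitialDataSet.momentumConstraintFn_apply, LinearMap.zero_apply,
      ← PseudoRiemannianMetric.divergence_eq_of_metric_eq hmet hindLC inferInstance D.k x]
    rw [hH] at hM
    exact hM

/-! ### Unconditional forms (the normal of every data embedding is smooth) -/

/-- **Data admitting a vacuum data embedding satisfy the vacuum constraints — unconditionally**: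
the smoothness hypothesis `hν` of `InitialDataSet.isVacuumConstraintSolution_of_dataEmbedding`
holds for every data embedding (`DataEmbedding.contMDiffAt_embed_normal`,
`DataEmbeddingNormalSmooth.lean`). Choquet-Bruhat 2009, Ch. VI, Thm. 3.3 (necessity of the
constraints); Wald 1984, (10.2.28)–(10.2.30). [cite: ChoquetBruhat2009, Ch. VI, Thm. 3.3] -/
theorem InitialDataSet.isVacuumConstraintSolution_of_isVacuum (𝒮 : DataEmbedding D)
    (h𝒮 : 𝒮.IsVacuum) [D.metric.HasLeviCivita] : D.IsVacuumConstraintSolution :=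
  InitialDataSet.isVacuumConstraintSolution_of_dataEmbedding 𝒮 h𝒮
    fun x ↦ 𝒮.contMDiffAt_embed_normal x

/-- **The data of a vacuum Cauchy development solve the vacuum constraint equations**
(Choquet-Bruhat 2009, Ch. VI, Thm. 3.3; Ringström 2009, Def. 16.3 with Ch. 14): in particular a
data set admitting a (maximal) vacuum Cauchy development is a vacuum constraint solution, so that
existence statements phrased for constraint solutions (such as
`choquetBruhat_geroch_exists_mghd_cauchy`) apply to developable data.
[cite: ChoquetBruhat2009, Ch. VI, Thm. 3.3] -/
theorem VacuumCauchyDevelopment.isVacuumConstraintSolution_data (𝒟 : VacuumCauchyDevelopment D)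
    [D.metric.HasLeviCivita] : D.IsVacuumConstraintSolution :=
  InitialDataSet.isVacuumConstraintSolution_of_isVacuum 𝒟.toDataEmbedding 𝒟.isVacuum

end Necessary

end Literature.Geometry.Lorentzian

end
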